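import Summits.BirchSwinnertonDyer.BirchSwinnertonDyer.Theorems.SemiOrdinaryEisensteinDescentWildKolyvaginUpperAtThreeOfPrimitives
import Literature.NumberTheory.EllipticCurves.CasselsTateLevelInputsOfCanonical
import HarnessLib

/-!
# Route `SemiOrdinaryEisensteinDescent`, crux Ko `WildKolyvaginUpperAtThree` (stmt-BirchSwinnertonDyer-20480), line
# `birth` v3: the Cassels–Tate conjunct of the print stub `stub_inputsPrim` PINNED TO THE CANONICAL FAMILY of local
# invariant maps — Ko BY NAME from J + Kolyvagin + {Ш³ = 0, Milne I 4.10(a) cochain form, Lemma 6.15,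
# conj-equivariance} + Gross 3.7 (2) + GZ86 III (3.1) (width seat `bsd-wall-soed-p2-w2` g2;
# `--supports stmt-BirchSwinnertonDyer-20480`; BSD is not proved by any of this)

WHY. Line `birth` v3 (lead soed-p2 g2) closes Ko by `WildKolyvaginUpperAtThreeOfPrimitives.wildKolyvaginUpperAtThree_of_sigma_of_primInputs`
from `stub_sigma` (= J, stmt-20760, the wall) and `stub_inputsPrim = (∀ kolyvagin) ∧ (∀ K, casselsTate_levelInputs K) ∧
prop37_2_frobeniusCongruence ∧ Gross1991_heegnerPoint_sub_ratTorsion_mem_E0`.  The second conjunct was filed (2026-08-27) with the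
remark «the tree has no local class field theory … size XL».  Two of its five clauses are in fact KERNEL THEOREMS for THE family
`LocalInvariants.canonical K n` (reciprocity `sumInvLocalizationEqZero_canonical_of_numberField`, cell bsd-cn100; local Tate
duality `LocalInvariants.canonical_isPerfect`), and the Literature theorem `casselsTate_levelInputs_of_canonical_inputs`
(`CasselsTateLevelInputsOfCanonical.lean`, this seat) pins `inv := canonical` and displays the exact residual: (iii)
`Ш³(K, μₙ) = 0`, (iv′) the two inputs `hPTc` / `h615` of `isLevelPairing_ctLevelPairing_of_inputs` (Milne I 4.10(a) in cochain
form, Lemma 6.15), (v) `conjAct`-invariance of `ctGeneralFun`.  THIS FILE threads that residual through the line's composition,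
so the print debt of line `birth` v3 reads, clause by clause: J (research) + Kolyvagin Thm. A + Gross 3.7 (2) + GZ86 III (3.1) +
{(iii), (iv′), (v) for the canonical family}.

WHAT IS PROVED (CONDITIONAL on every displayed hypothesis; nothing is asserted about any curve):
* `mcCallumUpper_of_canonicalInputs_of_frobeniusCongruence_of_E0` — McCallum 1991 Cor. 5.6, upper form
  (`McCallum1991_padicValNat_card_sha_primary_add_le_of_globalDivisibility`), from the canonical-family residual + 3.7 (2) + E0
  (= bsd-stepL's `…_of_casselsTate_of_frobeniusCongruence_of_E0` ∘ `casselsTate_levelInputs_of_canonical_inputs`).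
* `wildKolyvaginUpperAtThree_of_sigma_of_canonicalInputs` — Ko BY NAME ⟸ J BY NAME + `∀ kolyvagin` + the same residual + 3.7 (2)
  + E0 (= p581112 `wildKolyvaginUpperAtThree_of_sigma_of_primitives` ∘ the Literature theorem).
Ko, J, the refined Kolyvagin conjecture at `3` and BSD stay open.

References: [MilneADT2006] I Cor. 2.3, Thm. 4.10 (a)(c), §6 Prop. 6.9, Thm. 6.13, Lemma 6.15; [CasselsFrohlichANT1967] VII §11;
[McCallumLMS1991] §5 Cor. 5.6; [GrossLMS1991] §3 Prop. 3.7 (2), §5 (5.1), §6; [GrossZagier1986] III (3.1); [Jetchev2008] Conj. 1.3.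
-/

set_option autoImplicit false
set_option linter.dupNamespace false -- `Summit.BirchSwinnertonDyer.BirchSwinnertonDyer.…` is the tree's layout (D-0017)

noncomputable section

open scoped Classical

namespace Summit.BirchSwinnertonDyer.BirchSwinnertonDyer.Theorems.WildKolyvaginUpperAtThreeOfCanonicalInputs

open WeierstrassCurve NumberField Field IsDedekindDomain Literature.NumberTheory.EllipticCurves
  Literature.NumberTheory.GaloisRepresentations Literature.NumberTheory.GaloisCohomology
  Summit.BirchSwinnertonDyer.BirchSwinnertonDyer.Theses.SemiOrdinaryEisensteinDescent
  Summit.BirchSwinnertonDyer.Rank1Residual.X11b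
open Literature.NumberTheory.GaloisRepresentations.DiscreteGaloisModule (mu)

section Residual

/-! ## §0 The canonical-family residual of `casselsTate_levelInputs`, as section hypotheses (verbatim from
`casselsTate_levelInputs_of_canonical_inputs`, universally over the number field `K : Type`) -/

variable
  (hH3 : ∀ (K : Type) [Field K] [NumberField K] (n : ℕ) [NeZero n] (x : galoisCohomology (mu K n) 3),
    (∀ v : Place K, galoisCohomology.localization (mu K n) v 3 x = 0) → x = 0)
  (hPTc : ∀ (K : Type) [Field K] [NumberField K] (W : WeierstrassCurve ℚ) [W.IsElliptic] (p M₀ : ℕ),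
    p.Prime → p ≠ 2 → 1 ≤ M₀ → ∀ [NeZero (p ^ M₀)]
      (e : geomTorsion (W.baseChange K) ((p ^ M₀ * p ^ M₀ : ℕ) : ℤ) →
        geomTorsion (W.baseChange K) ((p ^ M₀ * p ^ M₀ : ℕ) : ℤ) → AlgebraicClosure K)
      (hμ : ∀ S T, e S T ^ (p ^ M₀ * p ^ M₀) = 1)
      (hadd₁ : ∀ S₁ S₂ T, e (S₁ + S₂) T = e S₁ T * e S₂ T)
      (hadd₂ : ∀ S T₁ T₂, e S (T₁ + T₂) = e S T₁ * e S T₂)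
      (hgal : ∀ (σ : absoluteGaloisGroup K)
        (S T : geomTorsion (W.baseChange K) ((p ^ M₀ * p ^ M₀ : ℕ) : ℤ)), σ • e S T = e (σ • S) (σ • T)),
      (∀ T, e T T = 1) → (∀ T, (∀ S, e S T = 1) → T = 0) →
      ∀ f : contTwoCocycles ((W.baseChange K).torsionGaloisModule ((p ^ M₀ : ℕ) : ℤ)).toTopRep,
        (∀ g : contOneCocycles ((W.baseChange K).torsionGaloisModule ((p ^ M₀ : ℕ) : ℤ)).toTopRep,
          (∀ v : Place K, locClass ((W.baseChange K).torsionGaloisModule ((p ^ M₀ : ℕ) : ℤ))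
              (Place.Completion v)
              (resOne ((W.baseChange K).torsionGaloisModule ((p ^ M₀ : ℕ) : ℤ)) (Place.Completion v) g) = 0) →
          ∃ (C : PTChoice (W.baseChange K) (p ^ M₀) e hμ hadd₁ hadd₂ hgal f g) (S : Finset (Place K)),
            (∀ v ∉ S, C.localTerm (LocalInvariants.canonical K (p ^ M₀ * p ^ M₀)) v = 0) ∧
              ∑ v ∈ S, C.localTerm (LocalInvariants.canonical K (p ^ M₀ * p ^ M₀)) v = 0) →
        twoCocycleClass _ f = 0)
  (h615 : ∀ (K : Type) [Field K] [NumberField K] (W : WeierstrassCurve ℚ) [W.IsElliptic] (p M₀ : ℕ),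
    p.Prime → p ≠ 2 → 1 ≤ M₀ → ∀ [NeZero (p ^ M₀)]
      (e : geomTorsion (W.baseChange K) ((p ^ M₀ * p ^ M₀ : ℕ) : ℤ) →
        geomTorsion (W.baseChange K) ((p ^ M₀ * p ^ M₀ : ℕ) : ℤ) → AlgebraicClosure K)
      (hμ : ∀ S T, e S T ^ (p ^ M₀ * p ^ M₀) = 1)
      (hadd₁ : ∀ S₁ S₂ T, e (S₁ + S₂) T = e S₁ T * e S₂ T)
      (hadd₂ : ∀ S T₁ T₂, e S (T₁ + T₂) = e S T₁ * e S T₂)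
      (hgal : ∀ (σ : absoluteGaloisGroup K)
        (S T : geomTorsion (W.baseChange K) ((p ^ M₀ * p ^ M₀ : ℕ) : ℤ)), σ • e S T = e (σ • S) (σ • T)),
      (∀ T, e T T = 1) → (∀ T, (∀ S, e S T = 1) → T = 0) →
      ∃ S₀ : Finset (Place K), ∀ S : Finset (Place K), S₀ ⊆ S →
        ∀ x : LocalClasses (W.baseChange K) (p ^ M₀) S,
          (∀ b' ∈ selmerGroup (W.baseChange K) ((p ^ M₀ : ℕ) : ℤ),
            sumPairing (W.baseChange K) (p ^ M₀) e hμ hadd₁ hadd₂ hgal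
              (LocalInvariants.canonical K (p ^ M₀ * p ^ M₀)) S x (locS (W.baseChange K) (p ^ M₀) S b') = 0) →
          ∃ b₀ ∈ kummerOutside (W.baseChange K) (p ^ M₀) S, ∀ v : S,
            x v - locS (W.baseChange K) (p ^ M₀) S b₀ v ∈
              (W.baseChange K).kummerLocalConditionAt ((p ^ M₀ : ℕ) : ℤ) (Place.Completion (v : Place K)))
  (hconj : ∀ (K : Type) [Field K] [NumberField K] (W : WeierstrassCurve ℚ) [W.IsElliptic] (p M₀ : ℕ),
    p.Prime → p ≠ 2 → 1 ≤ M₀ → ∀ [NeZero (p ^ M₀)] (c : K ≃ₐ[ℚ] K), c ≠ 1 → c * c = 1 →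
    ∀ (e : geomTorsion (W.baseChange K) ((p ^ M₀ * p ^ M₀ : ℕ) : ℤ) →
        geomTorsion (W.baseChange K) ((p ^ M₀ * p ^ M₀ : ℕ) : ℤ) → AlgebraicClosure K)
      (hμ : ∀ S T, e S T ^ (p ^ M₀ * p ^ M₀) = 1)
      (hadd₁ : ∀ S₁ S₂ T, e (S₁ + S₂) T = e S₁ T * e S₂ T)
      (hadd₂ : ∀ S T₁ T₂, e S (T₁ + T₂) = e S T₁ * e S T₂)
      (hgal : ∀ (σ : absoluteGaloisGroup K)
        (S T : geomTorsion (W.baseChange K) ((p ^ M₀ * p ^ M₀ : ℕ) : ℤ)), σ • e S T = e (σ • S) (σ • T)),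
      (∀ T, e T T = 1) → (∀ T, (∀ S, e S T = 1) → T = 0) →
      ∀ z ∈ selmerGroup (W.baseChange K) ((p ^ M₀ * p ^ M₀ : ℕ) : ℤ),
        ∀ t ∈ selmerGroup (W.baseChange K) ((p ^ M₀ * p ^ M₀ : ℕ) : ℤ),
        ctGeneralFun (W.baseChange K) (p ^ M₀) e hμ hadd₁ hadd₂ hgal
            (LocalInvariants.canonical K (p ^ M₀ * p ^ M₀))
            (torsionH1ToH1 (W.baseChange K) _ (conjAct W c _ z))
            (torsionH1ToH1 (W.baseChange K) _ (conjAct W c _ t)) =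
          ctGeneralFun (W.baseChange K) (p ^ M₀) e hμ hadd₁ hadd₂ hgal
            (LocalInvariants.canonical K (p ^ M₀ * p ^ M₀))
            (torsionH1ToH1 (W.baseChange K) _ z) (torsionH1ToH1 (W.baseChange K) _ t))

include hH3 hPTc h615 hconj

/-- **The CT conjunct of `stub_inputsPrim`, for every number field, from the canonical-family residual**: pointwise
`casselsTate_levelInputs_of_canonical_inputs`. CONDITIONAL on `hH3`, `hPTc`, `h615`, `hconj`.
[cite: MilneADT2006, Ch. I Cor. 2.3, Thm. 4.10(a)(c), §6 Prop. 6.9, Thm. 6.13(a), Lemma 6.15] [cite: CasselsFrohlichANT1967, Ch. VII §11] -/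
theorem forall_casselsTate_levelInputs_of_canonicalInputs :
    ∀ (K : Type) [Field K] [NumberField K], casselsTate_levelInputs K :=
  fun K _ _ ↦ casselsTate_levelInputs_of_canonical_inputs K (hH3 K) (hPTc K) (h615 K) (hconj K)

/-- **McCallum 1991 Cor. 5.6, upper form (the named fact `McCallum1991_padicValNat_card_sha_primary_add_le_of_globalDivisibility`),
from the canonical-family residual of the Cassels–Tate inputs + Gross 1991 Prop. 3.7 (2) (image-free) + GZ86 III (3.1)** —
bsd-stepL's kernel derivation `McCallum1991_…_of_casselsTate_of_frobeniusCongruence_of_E0` fed with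
`forall_casselsTate_levelInputs_of_canonicalInputs`. CONDITIONAL on the six displayed hypotheses.
[cite: McCallumLMS1991, §5 Cor. 5.6 (p. 310)] [cite: GrossLMS1991, §3 Prop. 3.7 (2) (p. 240), §6] [cite: GrossZagier1986, III (3.1)] -/
theorem mcCallumUpper_of_canonicalInputs_of_frobeniusCongruence_of_E0
    (h372 : GrossLMS1991.prop37_2_frobeniusCongruence) (hE0 : Gross1991_heegnerPoint_sub_ratTorsion_mem_E0) :
    McCallum1991_padicValNat_card_sha_primary_add_le_of_globalDivisibility :=
  McCallum1991_padicValNat_card_sha_primary_add_le_of_globalDivisibility_of_casselsTate_of_frobeniusCongruence_of_E0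
    (forall_casselsTate_levelInputs_of_canonicalInputs hH3 hPTc h615 hconj) h372 hE0

/-- **Crux Ko `WildKolyvaginUpperAtThree` BY NAME ⟸ J `WildSigmaDivisibilityAtThree` BY NAME (stmt-20760, OPEN) + Kolyvagin 1990
Thm. A + the canonical-family residual {`Ш³ = 0`, Milne I 4.10(a) cochain form, Lemma 6.15, `conjAct`-invariance} + Gross 3.7 (2)
+ GZ86 III (3.1)** — line `birth` v3's composition `wildKolyvaginUpperAtThree_of_sigma_of_primitives` (p581112: w2's McCallum road
under the crux's tower binder ∘ bsd-stepL's kernel Cor. 5.6) with its Cassels–Tate conjunct supplied by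
`forall_casselsTate_levelInputs_of_canonicalInputs`. CONDITIONAL on every displayed hypothesis; Ko and J stay open.
[cite: McCallumLMS1991, §5 Cor. 5.6 (p. 310)] [cite: Jetchev2008, Conj. 1.3 (p. 812)] [cite: MilneADT2006, Ch. I §6 Thm. 6.13(a)] -/
theorem wildKolyvaginUpperAtThree_of_sigma_of_canonicalInputs (hJ : WildSigmaDivisibilityAtThree)
    (hKo : ∀ (N : ℕ) [NeZero N] (W : WeierstrassCurve ℚ) (K : Type) [Field K] [NumberField K],
      kolyvagin N W K)
    (h372 : GrossLMS1991.prop37_2_frobeniusCongruence) (hE0 : Gross1991_heegnerPoint_sub_ratTorsion_mem_E0) :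
    WildKolyvaginUpperAtThree :=
  WildKolyvaginUpperAtThreeOfPrimitives.wildKolyvaginUpperAtThree_of_sigma_of_primitives hJ hKo
    (forall_casselsTate_levelInputs_of_canonicalInputs hH3 hPTc h615 hconj) h372 hE0

end Residual

end Summit.BirchSwinnertonDyer.BirchSwinnertonDyer.Theorems.WildKolyvaginUpperAtThreeOfCanonicalInputs

end
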